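import Summits.KontsevichZagierPeriods.KontsevichZagierPeriods.Theorems.HermiteRigidityRealEllipticSectorKernel
import Literature.NumberTheory.Transcendental.KZKernelConjectureForms

/-!
# Line `GenusTwoRealSectorKernel` — a RUNG LINE on crux `AyoubEffectiveCubeKernel`
(stmt-KontsevichZagierPeriods-18116; routes HermiteRigidity (parent, closed-served), SphericalSchlafli,
CoactionDevissage, TorsionLogs, EulerFormChain — piece X₂ of the split of `ReductionRigidity` stmt-3407)

FORWARD (rung-harvest of seat fwd-rung-KontsevichZagierPeriods-04, G1 next-rung; FORWARD DISCIPLINE F2):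
* generator = rung ; seed = g1-KontsevichZagierPeriods-10632 ;
* floor / witness = `Summit.KontsevichZagierPeriods.HermiteRigidity.RealEllipticSectorKernel.RealEllipticSectorKernel_proof`
  (stmt-KontsevichZagierPeriods-10632, PROVED) = `Rung 1` — compiled witness `Lines/GenusTwoRealSectorKernel_special.lean`
  (`theorem rung_one : Rung 1`, no sorry);
* rung_decl = `Summit.KontsevichZagierPeriods.KontsevichZagierPeriods.Theses.RealHyperellipticLadder.GenusTwoRealSectorKernel`
  (`:= Rung 2`; the decl names of the source seat are kept verbatim so the banked evidence #55–58 on stmt-10632 stays valid);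
* step = dimension/degree: genus 1 → 2 (Weierstrass cubic → rational depressed quintic with five real roots; rigid basis
  4 → 16 bounded-oval values);
* gap_after = every `Rung g` stays inside the 1-period layer (there Conjecture 1 is a corollary of the cite-only apex
  `Literature.NumberTheory.Transcendental.HuberWustholzCurvePeriods` via the landed
  `realOnePeriodRelations_of_huberWustholzCurvePeriods` + `M₁_le_relations`); above the layer no linear-independence input
  exists (HW 2022 p.12, p.14) — ladder_ceiling capped-at-1-period-sectors, disposition frontier.

HOW IT ADVANCES THE CRUX (honesty clause). X₂ = Ayoub 2015 Conj. 1.1 at `k = ℚ` is the transcendence leaf of the split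
`CubeResolution ∧ AyoubEffectiveCubeKernel → ReductionRigidity (⟺ summit)`; with cube resolution in dimension ≤ 1 LANDED
(`cubeResolution_dim_le_one`, Cruxes/ReductionRigidity/SplitR1CubeResolutionDimLeOne.lean) its CURVE SECTOR carries
Conjecture 1 for all dimension-≤ 1 data (crux idea
`Ideas/curve-sector-chain-rule.md`), of which every `Rung g` is an instance. This line does NOT conclude X₂: it is the
next THEOREM-GRADE rung of that sector beyond the proved genus-1 floor, on the KZ side, with the transcendence input
INLINED as a per-curve rigidity hypothesis (`Rigid 2`, true iff `End J` is generic — Wüstholz) instead of the apex, so it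
is provable now. `rung_two_of_summit` records that the rung is a consequence of the summit (F4); the witness pins the
other end to the proved floor (F3).

THE SKELETON (sorries ONLY in the five stubs; `GenusTwoRealSectorKernel_of : GenusTwoRealSectorKernel` kernel-checked):
* `stub_basis`      — the sixteen basis representations `[posOval j, xᵏ/√f]`, `[negOval j, xᵏ/√(−f)]`
                       (`j < 2`, `k < 4`) exist (integrability from rigidity ≠ 0, semialgebraicity
                       from algebraic roots).                                              [S/M]
* `stub_posReduction` / `stub_negReduction` — HERMITE IN DEGREE FIVE: every `[posOval j, xᵐ/√f]`
                       (`[negOval j, xᵐ/√(−f)]`) is, after an integer multiple, congruent modulo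
                       `KZ.relations` to a `ℤ`-combination of the four basis reps of ITS oval
                       (rule-3 exact forms `d(Q√(±f))` vanishing at both roots; the floor's
                       `stub_reduction` is the case `natDegree = 3`).                          [M]
* `stub_unboundedTransfer` — THE NEW IDEA (where the floor's `stub_twoTorsion` stops: no
                       automorphism of a genus-2 curve carries `(e₀,∞)` onto a bounded oval): the
                       real cycle relation `[(e₀,∞), xᵐ/√f] − [(e₂,e₁), xᵐ/√f] + [(e₄,e₃), xᵐ/√f]
                       ∈ KZ.relations` for `m = 0, 1` (value `C − B + A = 0`, Cauchy on the upper
                       half plane; a 2-dimensional Green/Stokes detour through the branch points,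
                       as in the one-curve theorem `GenusTwoCycleTransfer_proof`, or Abel
                       contraction; engines landed: `BetaLinearSector.greenInRelations`).          [L]
* `stub_basisKernel` — RIGIDITY ⇒ KERNEL on the free part: a `ℤ`-combination of the sixteen basis
                       classes of value `0` is a relation (soundness, ℚ-rigidity from `Rigid 2`,
                       zero coefficients).                                                    [M]
Composition = the parent's `ReducibleRigidTemplate` + integer division (`kernel_template`, proved) →
`rung_two_of` (proved, parametric in the five stub statements) → `GenusTwoRealSectorKernel_of`.
-/

noncomputable section

-- `Summit.KontsevichZagierPeriods.KontsevichZagierPeriods.…` is the tree's mandated layout (single-conjunct summit).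
set_option linter.dupNamespace false

open MeasureTheory Set

namespace Summit.KontsevichZagierPeriods.KontsevichZagierPeriods.Theses.RealHyperellipticLadder

open Literature.NumberTheory.Transcendental

/-- The depressed polynomial of degree `2g+1` with leading coefficient `4` and rational lower
coefficients: `f(x) = 4x^(2g+1) − Σ_{i<2g} qᵢ xⁱ` (`g = 1`: the Weierstrass cubic `4x³ − q₁x − q₀`). -/
def hyp (g : ℕ) (q : ℕ → ℚ) (x : ℝ) : ℝ :=
  4 * x ^ (2 * g + 1) - ∑ i ∈ Finset.range (2 * g), (q i : ℝ) * x ^ i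

/-- The `j`-th bounded oval with `f > 0` (counted from the right): `(e(2j+2), e(2j+1))`. -/
def posOval (e : ℕ → ℝ) (j : ℕ) : Set (Fin 1 → ℝ) := {p | e (2 * j + 2) < p 0 ∧ p 0 < e (2 * j + 1)}

/-- The `j`-th bounded oval with `f < 0` (counted from the right): `(e(2j+1), e(2j))`. -/
def negOval (e : ℕ → ℝ) (j : ℕ) : Set (Fin 1 → ℝ) := {p | e (2 * j + 1) < p 0 ∧ p 0 < e (2 * j)}

/-- The unbounded component `(e 0, ∞)` of `{f > 0}`. -/
def unb (e : ℕ → ℝ) : Set (Fin 1 → ℝ) := {p | e 0 < p 0}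

/-- `A j k = ∫_{posOval j} x^k dx/√f`. -/
def Aval (g : ℕ) (q : ℕ → ℚ) (e : ℕ → ℝ) (j k : ℕ) : ℝ :=
  ∫ p in posOval e j, p 0 ^ k / Real.sqrt (hyp g q (p 0))

/-- `B j k = ∫_{negOval j} x^k dx/√(−f)`. -/
def Bval (g : ℕ) (q : ℕ → ℚ) (e : ℕ → ℝ) (j k : ℕ) : ℝ :=
  ∫ p in negOval e j, p 0 ^ k / Real.sqrt (- hyp g q (p 0))

/-- RIGIDITY (inlined transcendence input, Wüstholz / Huber–Wüstholz for `End J = ℤ`): `1` and the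
`4g²` numbers `A j k`, `B j k` (`j < g`, `k < 2g`) are linearly independent over the real algebraic
numbers. (`g = 1`: the floor's hypothesis on `1, J₀, J₁, K₀, K₁`.) -/
def Rigid (g : ℕ) (q : ℕ → ℚ) (e : ℕ → ℝ) : Prop :=
  ∀ (a₀ : ℝ) (a b : ℕ → ℕ → ℝ), IsAlgebraic ℚ a₀ → (∀ j k, IsAlgebraic ℚ (a j k)) →
    (∀ j k, IsAlgebraic ℚ (b j k)) →
    a₀ + ∑ j ∈ Finset.range g, ∑ k ∈ Finset.range (2 * g),
        (a j k * Aval g q e j k + b j k * Bval g q e j k) = 0 →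
    a₀ = 0 ∧ ∀ j < g, ∀ k < 2 * g, a j k = 0 ∧ b j k = 0

/-- The generators of the real hyperelliptic sector of genus `g`. -/
def Gens (g : ℕ) (q : ℕ → ℚ) (e : ℕ → ℝ) : Set KZ.FormalRep :=
  {c | ∃ (r : KZ.IntegralRep 1) (j m : ℕ), j < g ∧ r.domain = posOval e j ∧
      EqOn r.integrand (fun p => p 0 ^ m / Real.sqrt (hyp g q (p 0))) (posOval e j) ∧
      c = KZ.of r} ∪
  {c | ∃ (r : KZ.IntegralRep 1) (j m : ℕ), j < g ∧ r.domain = negOval e j ∧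
      EqOn r.integrand (fun p => p 0 ^ m / Real.sqrt (- hyp g q (p 0))) (negOval e j) ∧
      c = KZ.of r} ∪
  {c | ∃ (r : KZ.IntegralRep 1) (m : ℕ), m < g ∧ r.domain = unb e ∧
      EqOn r.integrand (fun p => p 0 ^ m / Real.sqrt (hyp g q (p 0))) (unb e) ∧
      c = KZ.of r}

/-- Kernel form of Conjecture 1 on the subgroup generated by `S`. -/
def KernelOn (S : Set KZ.FormalRep) : Prop :=
  ∀ c ∈ AddSubgroup.closure S, KZ.eval c = 0 → c ∈ KZ.relations

/-- **The ladder.** `Rung g`: for every rational depressed polynomial of degree `2g+1` (leading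
coefficient `4`) with `2g+1` ordered real roots, RIGIDITY of the `1 + 4g²` bounded-oval values
implies the kernel form on the real hyperelliptic sector. `Rung 1` = the floor
`RealEllipticSectorKernel`; `Rung 2` = the next rung. -/
def Rung (g : ℕ) : Prop :=
  ∀ (q : ℕ → ℚ) (e : ℕ → ℝ), (∀ i < 2 * g, e (i + 1) < e i) →
    (∀ x, hyp g q x = 4 * ∏ i ∈ Finset.range (2 * g + 1), (x - e i)) →
    Rigid g q e → KernelOn (Gens g q e)

/-- **THE RUNG (`Rung 2`): the real genus-two sector.** For `f = 4x⁵ − q₃x³ − q₂x² − q₁x − q₀`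
rational with five real roots `e₀ > ⋯ > e₄`: IF `1` and the sixteen numbers
`∫_{(e₂,e₁)} xᵏ/√f, ∫_{(e₄,e₃)} xᵏ/√f, ∫_{(e₁,e₀)} xᵏ/√(−f), ∫_{(e₃,e₂)} xᵏ/√(−f)` (`k < 4`) are
linearly independent over the real algebraic numbers THEN every value-`0` `ℤ`-combination of
`[(e₂,e₁), xᵐ/√f], [(e₄,e₃), xᵐ/√f], [(e₁,e₀), xᵐ/√(−f)], [(e₃,e₂), xᵐ/√(−f)]` (all `m`) and
`[(e₀,∞), xᵐ/√f]` (`m ≤ 1`) lies in `KZ.relations`. -/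
def GenusTwoRealSectorKernel : Prop := Rung 2

/-! ## Fixed data of the genus-two rung -/

/-- Ordered roots `e₀ > e₁ > e₂ > e₃ > e₄`. -/
def Ordered (e : ℕ → ℝ) : Prop := ∀ i < 2 * 2, e (i + 1) < e i

/-- The factorisation `f = 4 ∏_{i<5} (x − eᵢ)` of the rational depressed quintic. -/
def Factored (q : ℕ → ℚ) (e : ℕ → ℝ) : Prop :=
  ∀ x, hyp 2 q x = 4 * ∏ i ∈ Finset.range (2 * 2 + 1), (x - e i)

/-- Specification of the sixteen basis representations. -/
def BasisSpec (q : ℕ → ℚ) (e : ℕ → ℝ) (A B : ℕ → ℕ → KZ.IntegralRep 1) : Prop :=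
  ∀ j < 2, ∀ k < 4,
    (A j k).domain = posOval e j ∧
    EqOn (A j k).integrand (fun p => p 0 ^ k / Real.sqrt (hyp 2 q (p 0))) (posOval e j) ∧
    (B j k).domain = negOval e j ∧
    EqOn (B j k).integrand (fun p => p 0 ^ k / Real.sqrt (- hyp 2 q (p 0))) (negOval e j)

/-- The set of the sixteen basis classes. -/
def basisSet (A B : ℕ → ℕ → KZ.IntegralRep 1) : Set KZ.FormalRep :=
  {c | ∃ j < 2, ∃ k < 4, c = KZ.of (A j k) ∨ c = KZ.of (B j k)}

/-! ## The five stubs -/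

/-- Stub 1 (S/M): the sixteen basis representations exist. -/
theorem stub_basis (q : ℕ → ℚ) (e : ℕ → ℝ) (he : Ordered e) (hf : Factored q e)
    (hR : Rigid 2 q e) : ∃ A B : ℕ → ℕ → KZ.IntegralRep 1, BasisSpec q e A B := by
  sorry

/-- Stub 2 (M): Hermite reduction in degree five on a positive bounded oval (integer normal form
over the four basis representations of that oval). -/
theorem stub_posReduction (q : ℕ → ℚ) (e : ℕ → ℝ) (he : Ordered e) (hf : Factored q e)
    (A B : ℕ → ℕ → KZ.IntegralRep 1) (hAB : BasisSpec q e A B) (j : ℕ) (hj : j < 2)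
    (r : KZ.IntegralRep 1) (m : ℕ) (hd : r.domain = posOval e j)
    (hi : EqOn r.integrand (fun p => p 0 ^ m / Real.sqrt (hyp 2 q (p 0))) (posOval e j)) :
    ∃ N : ℕ, 0 < N ∧ ∃ n : ℕ → ℤ,
      N • KZ.of r - ∑ k ∈ Finset.range 4, n k • KZ.of (A j k) ∈ KZ.relations := by
  sorry

/-- Stub 3 (M): Hermite reduction in degree five on a negative bounded oval. -/
theorem stub_negReduction (q : ℕ → ℚ) (e : ℕ → ℝ) (he : Ordered e) (hf : Factored q e)
    (A B : ℕ → ℕ → KZ.IntegralRep 1) (hAB : BasisSpec q e A B) (j : ℕ) (hj : j < 2)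
    (r : KZ.IntegralRep 1) (m : ℕ) (hd : r.domain = negOval e j)
    (hi : EqOn r.integrand (fun p => p 0 ^ m / Real.sqrt (- hyp 2 q (p 0))) (negOval e j)) :
    ∃ N : ℕ, 0 < N ∧ ∃ n : ℕ → ℤ,
      N • KZ.of r - ∑ k ∈ Finset.range 4, n k • KZ.of (B j k) ∈ KZ.relations := by
  sorry

/-- Stub 4 (L) — THE NEW IDEA: the real cycle relation of the genus-two curve as a KZ relation,
for the two forms integrable at infinity (`m = 0, 1`):
`[(e₀,∞), xᵐ/√f] − [(e₂,e₁), xᵐ/√f] + [(e₄,e₃), xᵐ/√f] ∈ KZ.relations`. -/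
theorem stub_unboundedTransfer (q : ℕ → ℚ) (e : ℕ → ℝ) (he : Ordered e) (hf : Factored q e)
    (m : ℕ) (hm : m < 2) (rU r₀ r₁ : KZ.IntegralRep 1)
    (hUd : rU.domain = unb e)
    (hUi : EqOn rU.integrand (fun p => p 0 ^ m / Real.sqrt (hyp 2 q (p 0))) (unb e))
    (h₀d : r₀.domain = posOval e 0)
    (h₀i : EqOn r₀.integrand (fun p => p 0 ^ m / Real.sqrt (hyp 2 q (p 0))) (posOval e 0))
    (h₁d : r₁.domain = posOval e 1)
    (h₁i : EqOn r₁.integrand (fun p => p 0 ^ m / Real.sqrt (hyp 2 q (p 0))) (posOval e 1)) :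
    KZ.of rU - KZ.of r₀ + KZ.of r₁ ∈ KZ.relations := by
  sorry

/-- Stub 5 (M): rigidity ⇒ kernel on the subgroup generated by the sixteen basis classes. -/
theorem stub_basisKernel (q : ℕ → ℚ) (e : ℕ → ℝ) (he : Ordered e) (hf : Factored q e)
    (hR : Rigid 2 q e) (A B : ℕ → ℕ → KZ.IntegralRep 1) (hAB : BasisSpec q e A B) :
    ∀ x ∈ AddSubgroup.closure (basisSet A B), KZ.eval x = 0 → x ∈ KZ.relations := by
  sorry

/-! ## Glue (proved): the reducible-rigid template with integer division -/

open Summit.KontsevichZagierPeriods.HermiteRigidity.RealEllipticSectorKernel (integerDivision) in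
/-- If every generator has an integer multiple congruent mod relations to an element of
`closure T`, and `closure T ∩ ker eval ≤ relations`, then `closure S ∩ ker eval ≤ relations`. -/
theorem kernel_template {S T : Set KZ.FormalRep}
    (h1 : ∀ s ∈ S, ∃ N : ℕ, 0 < N ∧ ∃ x ∈ AddSubgroup.closure T, N • s - x ∈ KZ.relations)
    (h2 : ∀ x ∈ AddSubgroup.closure T, KZ.eval x = 0 → x ∈ KZ.relations) :
    KernelOn S := by
  intro c hc hc0
  -- normal forms are closed under the group operations
  have hnf : ∃ N : ℕ, 0 < N ∧ ∃ x ∈ AddSubgroup.closure T, N • c - x ∈ KZ.relations := by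
    refine AddSubgroup.closure_induction (p := fun c _ =>
        ∃ N : ℕ, 0 < N ∧ ∃ x ∈ AddSubgroup.closure T, N • c - x ∈ KZ.relations)
      (fun s hs => h1 s hs) ?_ ?_ ?_ hc
    · exact ⟨1, one_pos, 0, zero_mem _, by simp⟩
    · rintro x y - - ⟨N, hN, a, ha, hx⟩ ⟨M, hM, b, hb, hy⟩
      refine ⟨N * M, Nat.mul_pos hN hM, (M : ℤ) • a + (N : ℤ) • b,
        add_mem (AddSubgroup.zsmul_mem _ ha _) (AddSubgroup.zsmul_mem _ hb _), ?_⟩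
      have key : (N * M) • (x + y) - ((M : ℤ) • a + (N : ℤ) • b)
          = (M : ℤ) • (N • x - a) + (N : ℤ) • (M • y - b) := by
        module
      rw [key]
      exact add_mem (AddSubgroup.zsmul_mem _ hx _) (AddSubgroup.zsmul_mem _ hy _)
    · rintro x - ⟨N, hN, a, ha, hx⟩
      refine ⟨N, hN, -a, neg_mem ha, ?_⟩
      have key : N • (-x) - (-a) = -(N • x - a) := by module
      rw [key]
      exact neg_mem hx
  obtain ⟨N, hN, x, hx, hrel⟩ := hnf
  -- soundness: `eval (N • c - x) = 0`, hence `eval x = 0`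
  have hsound : KZ.eval (N • c - x) = 0 :=
    (AddMonoidHom.mem_ker).1 (KZ.relations_le_ker_eval_holds hrel)
  have hx0 : KZ.eval x = 0 := by
    simp only [map_sub, map_nsmul, hc0, smul_zero, zero_sub, neg_eq_zero] at hsound
    exact hsound
  have hxrel : x ∈ KZ.relations := h2 x hx hx0
  have hNc : N • c ∈ KZ.relations := by
    have : N • c = (N • c - x) + x := by abel
    rw [this]
    exact add_mem hrel hxrel
  exact integerDivision c hN hNc

/-! ## Composition (proved) -/

/-- **The five stub STATEMENTS compose to `Rung 2`** (parametric form; sorry-free). -/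
theorem rung_two_of
    (hbasis : ∀ (q : ℕ → ℚ) (e : ℕ → ℝ), Ordered e → Factored q e → Rigid 2 q e →
      ∃ A B : ℕ → ℕ → KZ.IntegralRep 1, BasisSpec q e A B)
    (hpos : ∀ (q : ℕ → ℚ) (e : ℕ → ℝ), Ordered e → Factored q e →
      ∀ (A B : ℕ → ℕ → KZ.IntegralRep 1), BasisSpec q e A B → ∀ j < 2,
      ∀ (r : KZ.IntegralRep 1) (m : ℕ), r.domain = posOval e j →
      EqOn r.integrand (fun p => p 0 ^ m / Real.sqrt (hyp 2 q (p 0))) (posOval e j) →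
      ∃ N : ℕ, 0 < N ∧ ∃ n : ℕ → ℤ,
        N • KZ.of r - ∑ k ∈ Finset.range 4, n k • KZ.of (A j k) ∈ KZ.relations)
    (hneg : ∀ (q : ℕ → ℚ) (e : ℕ → ℝ), Ordered e → Factored q e →
      ∀ (A B : ℕ → ℕ → KZ.IntegralRep 1), BasisSpec q e A B → ∀ j < 2,
      ∀ (r : KZ.IntegralRep 1) (m : ℕ), r.domain = negOval e j →
      EqOn r.integrand (fun p => p 0 ^ m / Real.sqrt (- hyp 2 q (p 0))) (negOval e j) →
      ∃ N : ℕ, 0 < N ∧ ∃ n : ℕ → ℤ,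
        N • KZ.of r - ∑ k ∈ Finset.range 4, n k • KZ.of (B j k) ∈ KZ.relations)
    (hunb : ∀ (q : ℕ → ℚ) (e : ℕ → ℝ), Ordered e → Factored q e →
      ∀ m < 2, ∀ (rU r₀ r₁ : KZ.IntegralRep 1), rU.domain = unb e →
      EqOn rU.integrand (fun p => p 0 ^ m / Real.sqrt (hyp 2 q (p 0))) (unb e) →
      r₀.domain = posOval e 0 →
      EqOn r₀.integrand (fun p => p 0 ^ m / Real.sqrt (hyp 2 q (p 0))) (posOval e 0) →
      r₁.domain = posOval e 1 →
      EqOn r₁.integrand (fun p => p 0 ^ m / Real.sqrt (hyp 2 q (p 0))) (posOval e 1) →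
      KZ.of rU - KZ.of r₀ + KZ.of r₁ ∈ KZ.relations)
    (hker : ∀ (q : ℕ → ℚ) (e : ℕ → ℝ), Ordered e → Factored q e → Rigid 2 q e →
      ∀ (A B : ℕ → ℕ → KZ.IntegralRep 1), BasisSpec q e A B →
      ∀ x ∈ AddSubgroup.closure (basisSet A B), KZ.eval x = 0 → x ∈ KZ.relations) :
    Rung 2 := by
  intro q e he hf hR
  obtain ⟨A, B, hAB⟩ := hbasis q e he hf hR
  -- basis classes lie in the closure of the basis set
  have hA : ∀ j < 2, ∀ k < 4, KZ.of (A j k) ∈ AddSubgroup.closure (basisSet A B) :=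
    fun j hj k hk => AddSubgroup.subset_closure ⟨j, hj, k, hk, Or.inl rfl⟩
  have hB : ∀ j < 2, ∀ k < 4, KZ.of (B j k) ∈ AddSubgroup.closure (basisSet A B) :=
    fun j hj k hk => AddSubgroup.subset_closure ⟨j, hj, k, hk, Or.inr rfl⟩
  refine kernel_template (T := basisSet A B) ?_ (hker q e he hf hR A B hAB)
  rintro s ((⟨r, j, m, hj, hd, hi, rfl⟩ | ⟨r, j, m, hj, hd, hi, rfl⟩) | ⟨r, m, hm, hd, hi, rfl⟩)
  · -- positive bounded oval: Hermite in degree five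
    obtain ⟨N, hN, n, hrel⟩ := hpos q e he hf A B hAB j hj r m hd hi
    refine ⟨N, hN, ∑ k ∈ Finset.range 4, n k • KZ.of (A j k), ?_, hrel⟩
    exact AddSubgroup.sum_mem _ fun k hk =>
      AddSubgroup.zsmul_mem _ (hA j hj k (Finset.mem_range.1 hk)) _
  · -- negative bounded oval
    obtain ⟨N, hN, n, hrel⟩ := hneg q e he hf A B hAB j hj r m hd hi
    refine ⟨N, hN, ∑ k ∈ Finset.range 4, n k • KZ.of (B j k), ?_, hrel⟩
    exact AddSubgroup.sum_mem _ fun k hk =>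
      AddSubgroup.zsmul_mem _ (hB j hj k (Finset.mem_range.1 hk)) _
  · -- the unbounded component: the real cycle relation onto the basis reps `A 0 m`, `A 1 m`
    have hm4 : m < 4 := by omega
    obtain ⟨h0d, h0i, -, -⟩ := hAB 0 (by norm_num) m hm4
    obtain ⟨h1d, h1i, -, -⟩ := hAB 1 (by norm_num) m hm4
    have hrel := hunb q e he hf m hm r (A 0 m) (A 1 m) hd hi h0d h0i h1d h1i
    refine ⟨1, one_pos, KZ.of (A 0 m) - KZ.of (A 1 m),
      sub_mem (hA 0 (by norm_num) m hm4) (hA 1 (by norm_num) m hm4), ?_⟩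
    have key : (1 : ℕ) • KZ.of r - (KZ.of (A 0 m) - KZ.of (A 1 m))
        = KZ.of r - KZ.of (A 0 m) + KZ.of (A 1 m) := by
      rw [one_smul]; abel
    rw [key]
    exact hrel

/-- **THE COMPOSITION (registered form): the rung `GenusTwoRealSectorKernel` BY NAME from the five stubs of this
line** (sorries only inside the stubs). -/
theorem GenusTwoRealSectorKernel_of : GenusTwoRealSectorKernel :=
  rung_two_of stub_basis stub_posReduction stub_negReduction stub_unboundedTransfer stub_basisKernel

/-! ## F4: the rung is a consequence of the summit (the floor pins the other end, `rung_one` in the special file) -/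

/-- `S → Rung 2` (two lines through the kernel form of Conjecture 1; informational, F4). -/
theorem rung_two_of_summit (hS : _root_.KontsevichZagierPeriods) : Rung 2 := by
  intro q e _ _ _ c _ hc0
  exact (kzKernelConjecture_iff_isRational.mpr (KontsevichZagierPeriods_iff.mp hS)) c hc0

end Summit.KontsevichZagierPeriods.KontsevichZagierPeriods.Theses.RealHyperellipticLadder

end
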